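import Mathlib

/-!
# The derivative axis and the heat axis on the planted-pair model, in closed form

The *planted-pair model* is the real entire function

`F(h) = ((h − γ)² + η²) · cos (h + φ)`,

a conjugate pair of zeros `γ ± iη` planted on the zero lattice of a cosine carrier of
spacing `π` (phase `φ`).  Both regularising flows used on the Riemann `Ξ`-function act on it
in closed form:

* repeated differentiation (`soloBlind_iteratedDeriv_planted`):
  `F^(m)(h) = ((h−γ)² + η² − m(m−1)) cos(h + φ + mπ/2) + 2m (h−γ) sin(h + φ + mπ/2)`;
* the backward heat (de Bruijn) flow `∂ₜG = −∂ₕ²G`, `G(0,·) = F`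
  (`soloBlindPlantedHeat`, `soloBlind_plantedHeat_pde`):
  `G(t,h) = eᵗ · ( ((h−γ)² + η² − 2t − 4t²) cos(h + φ) + 4t (h−γ) sin(h + φ) )`.

Both land in the same two-parameter family: at the mid-gap phase of the relevant carrier the
profile around the planting point is `Φ_{c,q}(x) = (x² + c) cos x + q·x·sin x`
(`soloBlindProfile`) with
`(c, q) = (η² − m(m−1), 2m)` for `m` derivatives and `(c, q) = (η² − 2t − 4t², 4t)` for heat
time `t` (`soloBlind_plantedDeriv_midgap`, `soloBlind_plantedHeat_midgap`).
On the central half-period `|x| < π/2` the profile has no zero when `c > 0`, a double zero at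
`x = 0` when `c = 0`, and a symmetric pair of simple real zeros when `c < 0`
(`soloBlind_profile_pos`, `soloBlind_profile_double`, `soloBlind_profile_zero`): the planted
pair has become real exactly when `c ≤ 0`, i.e. when `η² ≤ m(m−1)` (derivatives) or
`η² ≤ 4t² + 2t` (heat).  Equating the two defects gives the exact exchange rate of the model,
`4t² + 2t = m(m−1) ↔ t = (m−1)/2` (`soloBlind_exchange`): `m` derivatives are worth de Bruijn
time `(m−1)·s²/(2π²)` at zero spacing `s` (here `s = π`), the long-wave rate `s²/(2π²)` per
derivative of Farmer–Rhoades with the first derivative spent.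

These identities are the kernel of the "derivative axis" cell of the solo-blind digest; the
statement that all *other* zeros of `F^(m)` and `G(t,·)` stay real is numerical there and is not
claimed here.
-/

noncomputable section

open Real Set

namespace Summit.RiemannHypothesis.RiemannHypothesis.Theorems

/-- The planted-pair model: a conjugate pair `γ ± iη` times a cosine carrier of phase `φ`. -/
def soloBlindPlanted (γ η φ : ℝ) : ℝ → ℝ :=
  fun h => ((h - γ) ^ 2 + η ^ 2) * cos (h + φ)

/-- Closed form of the `m`-th derivative of the planted-pair model. -/
def soloBlindPlantedDeriv (γ η φ : ℝ) (m : ℕ) : ℝ → ℝ :=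
  fun h => ((h - γ) ^ 2 + η ^ 2 - (m : ℝ) * ((m : ℝ) - 1)) * cos (h + (φ + (m : ℝ) * π / 2))
    + 2 * (m : ℝ) * (h - γ) * sin (h + (φ + (m : ℝ) * π / 2))

/-- The closed forms differentiate into each other: `(E_m)' = E_{m+1}`. -/
theorem soloBlind_hasDerivAt_plantedDeriv (γ η φ : ℝ) (m : ℕ) (h : ℝ) :
    HasDerivAt (soloBlindPlantedDeriv γ η φ m) (soloBlindPlantedDeriv γ η φ (m + 1) h) h := by
  have hc : HasDerivAt (fun y : ℝ => y + (φ + (m : ℝ) * π / 2)) 1 h := (hasDerivAt_id h).add_const _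
  have hcos : HasDerivAt (fun y : ℝ => cos (y + (φ + (m : ℝ) * π / 2)))
      (-sin (h + (φ + (m : ℝ) * π / 2)) * 1) h := (hasDerivAt_cos _).comp h hc
  have hsin : HasDerivAt (fun y : ℝ => sin (y + (φ + (m : ℝ) * π / 2)))
      (cos (h + (φ + (m : ℝ) * π / 2)) * 1) h := (hasDerivAt_sin _).comp h hc
  have h0 : HasDerivAt (fun y : ℝ => y - γ) 1 h := (hasDerivAt_id h).sub_const γ
  have hp : HasDerivAt (fun y : ℝ => (y - γ) ^ 2 + η ^ 2 - (m : ℝ) * ((m : ℝ) - 1))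
      (2 * (h - γ)) h :=
    (((h0.pow 2).add_const (η ^ 2)).sub_const ((m : ℝ) * ((m : ℝ) - 1))).congr_deriv (by norm_num)
  have hl : HasDerivAt (fun y : ℝ => 2 * (m : ℝ) * (y - γ)) (2 * (m : ℝ)) h :=
    (h0.const_mul (2 * (m : ℝ))).congr_deriv (by ring)
  have e1 : h + (φ + ((m : ℝ) + 1) * π / 2) = (h + (φ + (m : ℝ) * π / 2)) + π / 2 := by ring
  exact ((hp.mul hcos).add (hl.mul hsin)).congr_deriv (by
    simp only [soloBlindPlantedDeriv, Nat.cast_add, Nat.cast_one]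
    rw [e1, cos_add_pi_div_two, sin_add_pi_div_two]
    ring)

/-- **Derivative axis, closed form.**
`F^(m)(h) = ((h−γ)² + η² − m(m−1)) cos(h + φ + mπ/2) + 2m (h−γ) sin(h + φ + mπ/2)`. -/
theorem soloBlind_iteratedDeriv_planted (γ η φ : ℝ) :
    ∀ m : ℕ, iteratedDeriv m (soloBlindPlanted γ η φ) = soloBlindPlantedDeriv γ η φ m
  | 0 => by
      funext h
      simp [soloBlindPlanted, soloBlindPlantedDeriv]
  | (m + 1) => by
      rw [iteratedDeriv_succ, soloBlind_iteratedDeriv_planted γ η φ m]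
      funext h
      exact (soloBlind_hasDerivAt_plantedDeriv γ η φ m h).deriv

/-- At the planting abscissa the `m`-th derivative is `(η² − m(m−1))·cos(γ + φ + mπ/2)`:
the pair's defect after `m` derivatives is `η² − m(m−1)`. -/
theorem soloBlind_iteratedDeriv_planted_self (γ η φ : ℝ) (m : ℕ) :
    iteratedDeriv m (soloBlindPlanted γ η φ) γ
      = (η ^ 2 - (m : ℝ) * ((m : ℝ) - 1)) * cos (γ + (φ + (m : ℝ) * π / 2)) := by
  rw [soloBlind_iteratedDeriv_planted]
  simp [soloBlindPlantedDeriv]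

/-- The central profile `Φ_{c,q}(x) = (x² + c) cos x + q x sin x`. -/
def soloBlindProfile (c q : ℝ) : ℝ → ℝ :=
  fun x => (x ^ 2 + c) * cos x + q * x * sin x

/-- **Mid-gap phase, derivatives.**  With the carrier phased so that after `m` derivatives the
pair sits mid-gap (`φ = −γ − mπ/2`), the `m`-th derivative around the planting point is the
profile with defect `c = η² − m(m−1)` and slope `q = 2m`. -/
theorem soloBlind_plantedDeriv_midgap (γ η : ℝ) (m : ℕ) (x : ℝ) :
    iteratedDeriv m (soloBlindPlanted γ η (-γ - (m : ℝ) * π / 2)) (γ + x)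
      = soloBlindProfile (η ^ 2 - (m : ℝ) * ((m : ℝ) - 1)) (2 * (m : ℝ)) x := by
  rw [soloBlind_iteratedDeriv_planted]
  simp only [soloBlindPlantedDeriv, soloBlindProfile]
  have e : γ + x + (-γ - (m : ℝ) * π / 2 + (m : ℝ) * π / 2) = x := by ring
  rw [e]
  ring

/-- The profile is even. -/
theorem soloBlind_profile_neg (c q x : ℝ) : soloBlindProfile c q (-x) = soloBlindProfile c q x := by
  simp only [soloBlindProfile, cos_neg, sin_neg]
  ring

/-- `x·sin x ≥ 0` on the central half-period. -/
theorem soloBlind_x_mul_sin_nonneg {x : ℝ} (hx : |x| < π / 2) : 0 ≤ x * sin x := by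
  rcases abs_lt.mp hx with ⟨h1, h2⟩
  rcases le_total 0 x with h | h
  · exact mul_nonneg h (sin_nonneg_of_nonneg_of_le_pi h (by linarith [pi_pos]))
  · have : 0 ≤ -x * sin (-x) :=
      mul_nonneg (by linarith) (sin_nonneg_of_nonneg_of_le_pi (by linarith) (by linarith [pi_pos]))
    simpa [sin_neg] using this

/-- **Positive defect: no zero in the central half-period.** -/
theorem soloBlind_profile_pos {c q x : ℝ} (hc : 0 < c) (hq : 0 ≤ q) (hx : |x| < π / 2) :
    0 < soloBlindProfile c q x := by
  rcases abs_lt.mp hx with ⟨h1, h2⟩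
  have hcos : 0 < cos x := cos_pos_of_mem_Ioo ⟨by linarith, h2⟩
  have hxs : 0 ≤ x * sin x := soloBlind_x_mul_sin_nonneg hx
  have h3 : 0 < (x ^ 2 + c) * cos x := mul_pos (by positivity) hcos
  have h4 : 0 ≤ q * x * sin x := by rw [mul_assoc]; exact mul_nonneg hq hxs
  simp only [soloBlindProfile]
  linarith

/-- **Zero defect: a double zero at the planting point** (the profile vanishes at `0` and is
positive on the punctured central half-period). -/
theorem soloBlind_profile_double {q : ℝ} (hq : 0 ≤ q) :
    soloBlindProfile 0 q 0 = 0 ∧ ∀ x : ℝ, x ≠ 0 → |x| < π / 2 → 0 < soloBlindProfile 0 q x := by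
  refine ⟨by simp [soloBlindProfile], fun x hx0 hx => ?_⟩
  rcases abs_lt.mp hx with ⟨h1, h2⟩
  have hcos : 0 < cos x := cos_pos_of_mem_Ioo ⟨by linarith, h2⟩
  have hxs : 0 ≤ x * sin x := soloBlind_x_mul_sin_nonneg hx
  have h3 : 0 < x ^ 2 * cos x := mul_pos (by positivity) hcos
  have h4 : 0 ≤ q * x * sin x := by rw [mul_assoc]; exact mul_nonneg hq hxs
  simp only [soloBlindProfile, add_zero]
  linarith

/-- **Negative defect: the pair has become real** — a symmetric pair of zeros `±x₀`,
`0 < x₀ < π/2`, in the central half-period. -/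
theorem soloBlind_profile_zero {c q : ℝ} (hc : c < 0) (hq : 0 < q) :
    ∃ x ∈ Ioo (0 : ℝ) (π / 2), soloBlindProfile c q x = 0 ∧ soloBlindProfile c q (-x) = 0 := by
  have hcont : ContinuousOn (soloBlindProfile c q) (Icc 0 (π / 2)) := by
    apply Continuous.continuousOn
    unfold soloBlindProfile
    fun_prop
  have h0 : soloBlindProfile c q 0 = c := by simp [soloBlindProfile]
  have h1 : soloBlindProfile c q (π / 2) = q * (π / 2) := by simp [soloBlindProfile]
  have hsub := intermediate_value_Ioo (le_of_lt (by positivity : (0 : ℝ) < π / 2)) hcont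
  have hmem : (0 : ℝ) ∈ Ioo (soloBlindProfile c q 0) (soloBlindProfile c q (π / 2)) := by
    rw [h0, h1]; exact ⟨hc, by positivity⟩
  obtain ⟨x, hx, hx0⟩ := hsub hmem
  exact ⟨x, hx, hx0, by rw [soloBlind_profile_neg]; exact hx0⟩

/-- Closed form of the backward heat (de Bruijn) flow of the planted-pair model. -/
def soloBlindPlantedHeat (γ η φ t : ℝ) : ℝ → ℝ :=
  fun h => exp t * (((h - γ) ^ 2 + η ^ 2 - 2 * t - 4 * t ^ 2) * cos (h + φ)
    + 4 * t * (h - γ) * sin (h + φ))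

/-- Its first `h`-derivative. -/
def soloBlindPlantedHeatD1 (γ η φ t : ℝ) : ℝ → ℝ :=
  fun h => exp t * ((2 * (h - γ) + 4 * t * (h - γ)) * cos (h + φ)
    + (4 * t - ((h - γ) ^ 2 + η ^ 2 - 2 * t - 4 * t ^ 2)) * sin (h + φ))

/-- Its second `h`-derivative. -/
def soloBlindPlantedHeatD2 (γ η φ t : ℝ) : ℝ → ℝ :=
  fun h => exp t * ((2 + 8 * t - ((h - γ) ^ 2 + η ^ 2 - 2 * t - 4 * t ^ 2)) * cos (h + φ)
    - (4 * (h - γ) + 4 * t * (h - γ)) * sin (h + φ))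

/-- Initial condition: `G(0,·) = F`. -/
theorem soloBlind_plantedHeat_zero (γ η φ : ℝ) :
    soloBlindPlantedHeat γ η φ 0 = soloBlindPlanted γ η φ := by
  funext h
  simp [soloBlindPlantedHeat, soloBlindPlanted]

/-- First `h`-derivative of the heat closed form. -/
theorem soloBlind_hasDerivAt_plantedHeat (γ η φ t h : ℝ) :
    HasDerivAt (soloBlindPlantedHeat γ η φ t) (soloBlindPlantedHeatD1 γ η φ t h) h := by
  have hc : HasDerivAt (fun y : ℝ => y + φ) 1 h := (hasDerivAt_id h).add_const _
  have hcos : HasDerivAt (fun y : ℝ => cos (y + φ)) (-sin (h + φ) * 1) h :=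
    (hasDerivAt_cos _).comp h hc
  have hsin : HasDerivAt (fun y : ℝ => sin (y + φ)) (cos (h + φ) * 1) h :=
    (hasDerivAt_sin _).comp h hc
  have h0 : HasDerivAt (fun y : ℝ => y - γ) 1 h := (hasDerivAt_id h).sub_const γ
  have hp : HasDerivAt (fun y : ℝ => (y - γ) ^ 2 + η ^ 2 - 2 * t - 4 * t ^ 2) (2 * (h - γ)) h :=
    ((((h0.pow 2).add_const (η ^ 2)).sub_const (2 * t)).sub_const (4 * t ^ 2)).congr_deriv
      (by norm_num)
  have hl : HasDerivAt (fun y : ℝ => 4 * t * (y - γ)) (4 * t) h :=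
    (h0.const_mul (4 * t)).congr_deriv (by ring)
  exact (((hp.mul hcos).add (hl.mul hsin)).const_mul (exp t)).congr_deriv (by
    simp only [soloBlindPlantedHeatD1]
    ring)

/-- Second `h`-derivative of the heat closed form. -/
theorem soloBlind_hasDerivAt_plantedHeatD1 (γ η φ t h : ℝ) :
    HasDerivAt (soloBlindPlantedHeatD1 γ η φ t) (soloBlindPlantedHeatD2 γ η φ t h) h := by
  have hc : HasDerivAt (fun y : ℝ => y + φ) 1 h := (hasDerivAt_id h).add_const _
  have hcos : HasDerivAt (fun y : ℝ => cos (y + φ)) (-sin (h + φ) * 1) h :=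
    (hasDerivAt_cos _).comp h hc
  have hsin : HasDerivAt (fun y : ℝ => sin (y + φ)) (cos (h + φ) * 1) h :=
    (hasDerivAt_sin _).comp h hc
  have h0 : HasDerivAt (fun y : ℝ => y - γ) 1 h := (hasDerivAt_id h).sub_const γ
  have hp : HasDerivAt (fun y : ℝ => 2 * (y - γ) + 4 * t * (y - γ)) (2 + 4 * t) h :=
    ((h0.const_mul 2).add (h0.const_mul (4 * t))).congr_deriv (by ring)
  have h2 : HasDerivAt (fun y : ℝ => (y - γ) ^ 2 + η ^ 2 - 2 * t - 4 * t ^ 2) (2 * (h - γ)) h :=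
    ((((h0.pow 2).add_const (η ^ 2)).sub_const (2 * t)).sub_const (4 * t ^ 2)).congr_deriv
      (by norm_num)
  have hl : HasDerivAt (fun y : ℝ => 4 * t - ((y - γ) ^ 2 + η ^ 2 - 2 * t - 4 * t ^ 2))
      (-(2 * (h - γ))) h := h2.const_sub (4 * t)
  exact (((hp.mul hcos).add (hl.mul hsin)).const_mul (exp t)).congr_deriv (by
    simp only [soloBlindPlantedHeatD2]
    ring)

/-- **Heat axis, closed form: the PDE.**  `∂ₜ G(t,h) = −∂ₕ² G(t,h)` for the closed form
`soloBlindPlantedHeat`, whose `h`-derivatives are `soloBlindPlantedHeatD1/D2`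
(`soloBlind_hasDerivAt_plantedHeat`, `soloBlind_hasDerivAt_plantedHeatD1`) and whose initial
value is the planted-pair model (`soloBlind_plantedHeat_zero`). -/
theorem soloBlind_plantedHeat_pde (γ η φ t h : ℝ) :
    HasDerivAt (fun τ : ℝ => soloBlindPlantedHeat γ η φ τ h) (-(soloBlindPlantedHeatD2 γ η φ t h)) t := by
  have he : HasDerivAt (fun τ : ℝ => exp τ) (exp t) t := hasDerivAt_exp t
  have hid : HasDerivAt (fun τ : ℝ => τ) 1 t := hasDerivAt_id t
  have h1 : HasDerivAt (fun τ : ℝ => 2 * τ) 2 t := (hid.const_mul 2).congr_deriv (by ring)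
  have h2 : HasDerivAt (fun τ : ℝ => 4 * τ ^ 2) (8 * t) t :=
    ((hid.pow 2).const_mul 4).congr_deriv (by norm_num; ring)
  have hP : HasDerivAt (fun τ : ℝ => (h - γ) ^ 2 + η ^ 2 - 2 * τ - 4 * τ ^ 2) (-(2 + 8 * t)) t :=
    ((h1.const_sub ((h - γ) ^ 2 + η ^ 2)).sub h2).congr_deriv (by ring)
  have hQ : HasDerivAt (fun τ : ℝ => 4 * τ * (h - γ)) (4 * (h - γ)) t :=
    ((hid.const_mul 4).mul_const (h - γ)).congr_deriv (by ring)
  have hin : HasDerivAt (fun τ : ℝ => ((h - γ) ^ 2 + η ^ 2 - 2 * τ - 4 * τ ^ 2) * cos (h + φ)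
      + 4 * τ * (h - γ) * sin (h + φ)) (-(2 + 8 * t) * cos (h + φ) + 4 * (h - γ) * sin (h + φ)) t :=
    (hP.mul_const _).add (hQ.mul_const _)
  exact (he.mul hin).congr_deriv (by
    simp only [soloBlindPlantedHeatD2]
    ring)

/-- **Mid-gap phase, heat.**  With `φ = −γ` the heat-flowed model around the planting point is
`eᵗ · Φ_{c,q}` with defect `c = η² − 2t − 4t²` and slope `q = 4t`. -/
theorem soloBlind_plantedHeat_midgap (γ η t x : ℝ) :
    soloBlindPlantedHeat γ η (-γ) t (γ + x)
      = exp t * soloBlindProfile (η ^ 2 - 2 * t - 4 * t ^ 2) (4 * t) x := by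
  simp only [soloBlindPlantedHeat, soloBlindProfile]
  have e : γ + x + -γ = x := by ring
  rw [e]
  ring

/-- **The exchange rate of the model.**  The derivative defect `η² − m(m−1)` and the heat defect
`η² − 2t − 4t²` coincide exactly when `t = (m−1)/2`: `m` derivatives ≙ de Bruijn time
`(m−1)/2 = (m−1)·s²/(2π²)` at spacing `s = π`. -/
theorem soloBlind_exchange {t : ℝ} (ht : 0 ≤ t) {m : ℕ} (hm : 1 ≤ m) :
    4 * t ^ 2 + 2 * t = (m : ℝ) * ((m : ℝ) - 1) ↔ t = ((m : ℝ) - 1) / 2 := by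
  have hm' : (1 : ℝ) ≤ (m : ℝ) := by exact_mod_cast hm
  constructor
  · intro h
    have hfac : (2 * t + 1 - (m : ℝ)) * (2 * t + (m : ℝ)) = 0 := by linear_combination h
    rcases mul_eq_zero.mp hfac with h1 | h2
    · linarith
    · linarith
  · intro h
    subst h
    ring

/-- The two thresholds in one line: after `m` derivatives the planted pair of the model is
real (defect `≤ 0`) iff `η² ≤ m(m−1)`, and under the heat flow iff `η² ≤ 4t² + 2t`; at the
exchange time `t = (m−1)/2` these are the same condition. -/
theorem soloBlind_defects_agree (η : ℝ) (m : ℕ) :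
    (η ^ 2 - 2 * (((m : ℝ) - 1) / 2) - 4 * (((m : ℝ) - 1) / 2) ^ 2)
      = η ^ 2 - (m : ℝ) * ((m : ℝ) - 1) := by
  ring

end Summit.RiemannHypothesis.RiemannHypothesis.Theorems

end
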